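import Summits.AtomisticToContinuum.Crystallization.Theorems.ExcessDecayLiouvilleSiteGeometry
import Summits.AtomisticToContinuum.Crystallization.Theorems.ExcessDecayLiouvilleHcpLiouvilleDefs

/-!
# `ExcessDecayLiouville.HcpLiouville` (stmt-AtomisticToContinuum-9332), line `Sketch`: the force balance in displacement coordinates

First step of stub `stub_flatDifferences` (level 2 of the two-level Caccioppoli argument).  If `X` is a
Lennard-Jones equilibrium (`Equil₀ X`) in displacement form over the reference sites `S = Sites₀ t A`
(`IsDisplacement X t A u`: `s ↦ s + u s` is a bijection `S → X`), then for every lattice vector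
`z ∈ Λ₀` the translate `u(· + Az)` is again a displacement of the SAME site set (`S + AΛ₀ = S`) onto the
translate `X − Az`, which is again an equilibrium; in coordinates: for every site `p`

`Σ_{q ∈ S ∖ {p}} F(p + u(p + Az) − (q + u(q + Az))) = 0`,  `F(e) = (V′(|e|)/|e|)·e`,

as a `HasSum` over `↥S` (`hasSum_force_displaced`; `z = 0` is the equation of `X` itself), and hence the
DIFFERENCE EQUATION `Σ_q [F(b_pq) − F(a_pq)] = 0` (`flatDiff_hasSum_force_difference`) for the two bond families
`a_pq = p + u p − (q + u q)`, `b_pq = p + u(p+Az) − (q + u(q+Az))`, whose unknown is the period difference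
`w = u(· + Az) − u`.  The proof is a reindexing of the `HasSum` of `Equil₀` by the bijection
`q ↦ (q + Az) + u(q + Az)` from `S ∖ {p}` onto `X ∖ {x_p}`.  All `[folklore]`; a `--supports` helper for
item stmt-AtomisticToContinuum-9332, nothing here closes an item.
-/

noncomputable section

namespace Summit.AtomisticToContinuum.Crystallization.Theorems.ExcessDecayLiouville

open scoped BigOperators Topology Classical InnerProductSpace
open Literature.MathematicalPhysics.StatisticalMechanics
open Summit.AtomisticToContinuum.Crystallization.Theses.ExcessDecayLiouville
open Summit.AtomisticToContinuum.Crystallization.Theorems.PhononStabilityNegative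

/-- The site set is stable under `+A Λ₀` (local copy of the bookkeeping fact). [folklore] -/
private theorem add_mem_sites₀' {t : Fin 2 → (EuclideanSpace ℝ (Fin 3))} {A : (EuclideanSpace ℝ (Fin 3)) →L[ℝ] (EuclideanSpace ℝ (Fin 3))} {p e : (EuclideanSpace ℝ (Fin 3))}
    (hp : p ∈ Sites₀ t A) (he : e ∈ Λ₀) : p + A e ∈ Sites₀ t A := by
  obtain ⟨m, z, hz, rfl⟩ := hp
  exact ⟨m, z + e, hcpLiouvilleLam_add_mem hz he, by rw [map_add, add_assoc]⟩

/-- The site set is stable under `−A Λ₀` (local copy of the bookkeeping fact). [folklore] -/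
private theorem sub_mem_sites₀' {t : Fin 2 → (EuclideanSpace ℝ (Fin 3))} {A : (EuclideanSpace ℝ (Fin 3)) →L[ℝ] (EuclideanSpace ℝ (Fin 3))} {p e : (EuclideanSpace ℝ (Fin 3))}
    (hp : p ∈ Sites₀ t A) (he : e ∈ Λ₀) : p - A e ∈ Sites₀ t A := by
  obtain ⟨m, z, hz, rfl⟩ := hp
  exact ⟨m, z - e, hcpLiouvilleLam_sub_mem hz he, by rw [map_sub, add_sub_assoc]⟩

/-- Passing between the `HasSum` over the punctured site set `{q ∈ S | q ≠ p}` and the `HasSum` over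
all sites of the family extended by `0` on the diagonal. [folklore] -/
private theorem hasSum_sites_ne_iff {t : Fin 2 → (EuclideanSpace ℝ (Fin 3))} {A : (EuclideanSpace ℝ (Fin 3)) →L[ℝ] (EuclideanSpace ℝ (Fin 3))} (p : (EuclideanSpace ℝ (Fin 3))) (G : (EuclideanSpace ℝ (Fin 3)) → (EuclideanSpace ℝ (Fin 3))) :
    HasSum (fun q : {q : (EuclideanSpace ℝ (Fin 3)) // q ∈ Sites₀ t A ∧ q ≠ p} => G q) 0 ↔
      HasSum (fun q : Sites₀ t A => if p ≠ q then G q else 0) 0 := by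
  have h1 := (hasSum_subtype_iff_indicator (f := G) (a := (0 : (EuclideanSpace ℝ (Fin 3))))
    (s := {q : (EuclideanSpace ℝ (Fin 3)) | q ∈ Sites₀ t A ∧ q ≠ p}))
  have h2 := (hasSum_subtype_iff_indicator (f := fun q : (EuclideanSpace ℝ (Fin 3)) => if p ≠ q then G q else 0) (a := (0 : (EuclideanSpace ℝ (Fin 3))))
    (s := Sites₀ t A))
  have heq : Set.indicator {q : (EuclideanSpace ℝ (Fin 3)) | q ∈ Sites₀ t A ∧ q ≠ p} G =
      Set.indicator (Sites₀ t A) (fun q : (EuclideanSpace ℝ (Fin 3)) => if p ≠ q then G q else 0) := by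
    funext q
    by_cases hq : q ∈ Sites₀ t A
    · by_cases hqp : q = p
      · subst hqp
        simp [hq]
      · rw [Set.indicator_of_mem (show q ∈ {q : (EuclideanSpace ℝ (Fin 3)) | q ∈ Sites₀ t A ∧ q ≠ p} from ⟨hq, hqp⟩),
          Set.indicator_of_mem hq, if_pos (Ne.symm hqp)]
    · rw [Set.indicator_of_notMem (fun h => hq h.1), Set.indicator_of_notMem hq]
  exact (h1.trans (by rw [heq])).trans h2.symm

/-- **Force balance of the translate, in displacement coordinates.**  For an equilibrium `X` in
displacement form `u` over the sites and a lattice vector `z ∈ Λ₀`, at every site `p` the pair forces of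
the bonds `p + u(p + Az) − (q + u(q + Az))`, `q ∈ S ∖ {p}`, sum to `0`. [folklore] -/
private theorem hasSum_force_displaced {X : Set (EuclideanSpace ℝ (Fin 3))} {t : Fin 2 → (EuclideanSpace ℝ (Fin 3))} {A : (EuclideanSpace ℝ (Fin 3)) →L[ℝ] (EuclideanSpace ℝ (Fin 3))} {u : (EuclideanSpace ℝ (Fin 3)) → (EuclideanSpace ℝ (Fin 3))}
    (hEq : Equil₀ X) (hD : IsDisplacement X t A u) {z : (EuclideanSpace ℝ (Fin 3))} (hz : z ∈ Λ₀) (p : Sites₀ t A) :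
    HasSum (fun q : Sites₀ t A => if (p : (EuclideanSpace ℝ (Fin 3))) ≠ q then
      (deriv lennardJones ‖(p : (EuclideanSpace ℝ (Fin 3))) + u (p + A z) - ((q : (EuclideanSpace ℝ (Fin 3))) + u (q + A z))‖ /
          ‖(p : (EuclideanSpace ℝ (Fin 3))) + u (p + A z) - ((q : (EuclideanSpace ℝ (Fin 3))) + u (q + A z))‖) •
        ((p : (EuclideanSpace ℝ (Fin 3))) + u (p + A z) - ((q : (EuclideanSpace ℝ (Fin 3))) + u (q + A z))) else 0) 0 := by
  have hbij := hD.2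
  -- the displaced point over `p + Az`
  set x₀ : (EuclideanSpace ℝ (Fin 3)) := ((p : (EuclideanSpace ℝ (Fin 3))) + A z) + u ((p : (EuclideanSpace ℝ (Fin 3))) + A z) with hx₀
  have hpz : (p : (EuclideanSpace ℝ (Fin 3))) + A z ∈ Sites₀ t A := add_mem_sites₀' p.2 hz
  have hx₀X : x₀ ∈ X := hbij.mapsTo hpz
  -- the reindexing map
  set ψ : {q : (EuclideanSpace ℝ (Fin 3)) // q ∈ Sites₀ t A ∧ q ≠ p} → {q' : (EuclideanSpace ℝ (Fin 3)) // q' ∈ X ∧ q' ≠ x₀} := fun q =>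
    ⟨(q : (EuclideanSpace ℝ (Fin 3))) + A z + u ((q : (EuclideanSpace ℝ (Fin 3))) + A z), hbij.mapsTo (add_mem_sites₀' q.2.1 hz), fun h =>
      q.2.2 (add_right_cancel (hbij.injOn (add_mem_sites₀' q.2.1 hz) hpz h))⟩ with hψ
  have hψbij : Function.Bijective ψ := by
    constructor
    · intro q₁ q₂ h
      have h' : (q₁ : (EuclideanSpace ℝ (Fin 3))) + A z + u ((q₁ : (EuclideanSpace ℝ (Fin 3))) + A z) = (q₂ : (EuclideanSpace ℝ (Fin 3))) + A z + u ((q₂ : (EuclideanSpace ℝ (Fin 3))) + A z) :=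
        congrArg Subtype.val h
      exact Subtype.ext (add_right_cancel
        (hbij.injOn (add_mem_sites₀' q₁.2.1 hz) (add_mem_sites₀' q₂.2.1 hz) h'))
    · intro q'
      obtain ⟨s, hs, hsq⟩ := hbij.surjOn q'.2.1
      refine ⟨⟨s - A z, sub_mem_sites₀' hs hz, fun h => q'.2.2 ?_⟩, ?_⟩
      · rw [← hsq, hx₀, ← h, sub_add_cancel]
      · exact Subtype.ext (by simp only [hψ, sub_add_cancel]; exact hsq)
  have h := ((Equiv.ofBijective ψ hψbij).hasSum_iff).2 (hEq x₀ hx₀X)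
  refine (hasSum_sites_ne_iff (p : (EuclideanSpace ℝ (Fin 3))) (fun q : (EuclideanSpace ℝ (Fin 3)) =>
    (deriv lennardJones ‖(p : (EuclideanSpace ℝ (Fin 3))) + u (p + A z) - (q + u (q + A z))‖ /
        ‖(p : (EuclideanSpace ℝ (Fin 3))) + u (p + A z) - (q + u (q + A z))‖) •
      ((p : (EuclideanSpace ℝ (Fin 3))) + u (p + A z) - (q + u (q + A z))))).1 ?_
  have hv : ∀ q : (EuclideanSpace ℝ (Fin 3)), x₀ - (q + A z + u (q + A z)) = (p : (EuclideanSpace ℝ (Fin 3))) + u (p + A z) - (q + u (q + A z)) := by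
    intro q; rw [hx₀]; abel
  convert h using 1
  funext q
  simp only [Function.comp_apply, Equiv.ofBijective_apply, hψ, dist_eq_norm, hv]

/-- **The difference equation.**  For an equilibrium `X` in displacement form `u` and `z ∈ Λ₀`, at every
site `p` the differences of the pair forces of the translated bonds `b_pq = p + u(p+Az) − (q + u(q+Az))`
and of the original bonds `a_pq = p + u p − (q + u q)` sum to `0` over `q ∈ S ∖ {p}`; its unknown is the
period difference `w = u(· + Az) − u` (`b_pq − a_pq = w p − w q`). [folklore] -/
theorem flatDiff_hasSum_force_difference {X : Set (EuclideanSpace ℝ (Fin 3))} {t : Fin 2 → (EuclideanSpace ℝ (Fin 3))} {A : (EuclideanSpace ℝ (Fin 3)) →L[ℝ] (EuclideanSpace ℝ (Fin 3))} {u : (EuclideanSpace ℝ (Fin 3)) → (EuclideanSpace ℝ (Fin 3))}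
    (hEq : Equil₀ X) (hD : IsDisplacement X t A u) {z : (EuclideanSpace ℝ (Fin 3))} (hz : z ∈ Λ₀) (p : Sites₀ t A) :
    HasSum (fun q : Sites₀ t A => if (p : (EuclideanSpace ℝ (Fin 3))) ≠ q then
      (deriv lennardJones ‖(p : (EuclideanSpace ℝ (Fin 3))) + u (p + A z) - ((q : (EuclideanSpace ℝ (Fin 3))) + u (q + A z))‖ /
          ‖(p : (EuclideanSpace ℝ (Fin 3))) + u (p + A z) - ((q : (EuclideanSpace ℝ (Fin 3))) + u (q + A z))‖) •
        ((p : (EuclideanSpace ℝ (Fin 3))) + u (p + A z) - ((q : (EuclideanSpace ℝ (Fin 3))) + u (q + A z))) -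
      (deriv lennardJones ‖(p : (EuclideanSpace ℝ (Fin 3))) + u p - ((q : (EuclideanSpace ℝ (Fin 3))) + u q)‖ / ‖(p : (EuclideanSpace ℝ (Fin 3))) + u p - ((q : (EuclideanSpace ℝ (Fin 3))) + u q)‖) •
        ((p : (EuclideanSpace ℝ (Fin 3))) + u p - ((q : (EuclideanSpace ℝ (Fin 3))) + u q)) else 0) 0 := by
  have h1 := hasSum_force_displaced hEq hD hz p
  have h0 := hasSum_force_displaced hEq hD zero_mem_Λ₀ p
  simp only [map_zero, add_zero] at h0
  have h := h1.sub h0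
  rw [sub_zero] at h
  convert h using 1
  funext q
  split_ifs <;> simp

/-- A translate of a displacement by a lattice vector is still bounded by `1/40` on the sites.
[folklore] -/
theorem flatDiff_norm_displaced_le {X : Set (EuclideanSpace ℝ (Fin 3))} {t : Fin 2 → (EuclideanSpace ℝ (Fin 3))} {A : (EuclideanSpace ℝ (Fin 3)) →L[ℝ] (EuclideanSpace ℝ (Fin 3))} {u : (EuclideanSpace ℝ (Fin 3)) → (EuclideanSpace ℝ (Fin 3))}
    (hD : IsDisplacement X t A u) {z : (EuclideanSpace ℝ (Fin 3))} (hz : z ∈ Λ₀) :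
    ∀ s ∈ Sites₀ t A, ‖u (s + A z)‖ ≤ 1 / 40 :=
  fun _ hs => hD.1 _ (add_mem_sites₀' hs hz)

/-- Registered form of `flatDiff_hasSum_force_difference` (sub-goal of crux stmt-AtomisticToContinuum-9332, line
`Sketch`): the difference equation of an equilibrium in displacement form and its translate by a period.
[folklore] -/
theorem hcpLiouville_hasSum_force_difference : ∀ (X : Set (EuclideanSpace ℝ (Fin 3))) (t : Fin 2 → (EuclideanSpace ℝ (Fin 3))) (A : (EuclideanSpace ℝ (Fin 3)) →L[ℝ] (EuclideanSpace ℝ (Fin 3))) (u : (EuclideanSpace ℝ (Fin 3)) → (EuclideanSpace ℝ (Fin 3))), Equil₀ X → IsDisplacement X t A u → ∀ z ∈ Λ₀, ∀ p : Sites₀ t A, HasSum (fun q : Sites₀ t A => if (p : (EuclideanSpace ℝ (Fin 3))) ≠ q then (deriv lennardJones ‖(p : (EuclideanSpace ℝ (Fin 3))) + u (p + A z) - ((q : (EuclideanSpace ℝ (Fin 3))) + u (q + A z))‖ / ‖(p : (EuclideanSpace ℝ (Fin 3))) + u (p + A z) - ((q : (EuclideanSpace ℝ (Fin 3))) + u (q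 + A z))‖) • ((p : (EuclideanSpace ℝ (Fin 3))) + u (p + A z) - ((q : (EuclideanSpace ℝ (Fin 3))) + u (q + A z))) - (deriv lennardJones ‖(p : (EuclideanSpace ℝ (Fin 3))) + u p - ((q : (EuclideanSpace ℝ (Fin 3))) + u q)‖ / ‖(p : (EuclideanSpace ℝ (Fin 3))) + u p - ((q : (EuclideanSpace ℝ (Fin 3))) + u q)‖) • ((p : (EuclideanSpace ℝ (Fin 3))) + u p - ((q : (EuclideanSpace ℝ (Fin 3))) + u q)) else 0) 0 := by
  intro X t A u hEq hD z hz p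
  exact flatDiff_hasSum_force_difference hEq hD hz p

end Summit.AtomisticToContinuum.Crystallization.Theorems.ExcessDecayLiouville

end
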